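import Summits.MatrixMultiplication.OmegaCensus.STPPSmallPatternT1NoneBridge45
import Summits.MatrixMultiplication.OmegaCensus.STPPSmallPatternNone211K6Z24
import Summits.MatrixMultiplication.OmegaCensus.STPPSmallPatternNone211K6P2x12
import Summits.MatrixMultiplication.OmegaCensus.STPPSmallPatternNone211K6P2x2x6
import Summits.MatrixMultiplication.OmegaCensus.STPPSmallPatternNone211K6Z25
import Summits.MatrixMultiplication.OmegaCensus.STPPSmallPatternNone211K6P5x5
import Summits.MatrixMultiplication.OmegaCensus.STPPSmallPatternNone211K6Z26

/-!
# ω-census, small STPP pattern `(2,1,1)^k`: NO finite abelian group of order `≤ 26` admits `(2,1,1)⁶` (kernel)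

HONEST FRAMING (pub-omega census; verbatim): lottery ticket; floor = certified bounds/negative ranges.
Census STRUCTURE bookkeeping of the STPP track (seat pub-omega-eng2 = ENG2, gen 33; STRUCTURE row B5, the threshold column
`T1(H) = max {k : (2,1,1)^k ⊆ H}` — the lower side of the `k = 6` ORDER LAW «`(2,1,1)⁶ ⊆ G ↔ 30 ≤ |G|`», whose host side
`exists_isSTPP_211pow6_of_card_ge_30` is in `STPPSmallPatternT1K6OrderLaw.lean`), not progress on `ω`: small patterns in small
groups bound no exponent.

First tranche of the twelve-cell NONE side (orders `24 … 29`): the SIX abelian groups of order `24, 25, 26` — `ℤ/24`,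
`ℤ/2 × ℤ/12`, `ℤ/2 × ℤ/2 × ℤ/6`, `ℤ/25`, `(ℤ/5)²`, `ℤ/26` — each a kernel mask search (`STPPSmallPatternNone211K6*.lean`,
engine `STPP211Neg.search`/`search2`, reflection `STPPSmallPatternKernelReflect` / `…KernelSearchX2`), assembled over ALL finite
abelian groups by the window bridge `not_exists_isSTPP_211_of_card_window45` (structure theorem + kernel domination core) and,
below order `24`, by stpp-3's `k = 5` lower side `not_exists_isSTPP_211pow5_of_card_le` (sub-families):

* `not_exists_isSTPP_211pow6_of_card_le_26` — **no finite abelian group of order `≤ 26` admits an STPP family of size pattern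
  `(2,1,1)⁶`** (CKSU Def. 5.1, tree `IsSTPP`).  The remaining cells `ℤ/27`, `ℤ/3 × ℤ/9`, `(ℤ/3)³`, `ℤ/28`, `ℤ/2 × ℤ/14`, `ℤ/29`
  (≈ 24 kernel-hours at the present engine, sized in HOME `pub-omega-eng2-g33/HANDOFF.md` §5) would close the law as an iff.

References: H. Cohn, R. Kleinberg, B. Szegedy, C. Umans, FOCS 2005 (arXiv:math/0511460), Def. 5.1.
-/

open Literature.Computability.AlgebraicComplexity Finset

namespace Summit.MatrixMultiplication.OmegaCensus

/-- A `(2,1,1)^k` exclusion for `ℤ/a × ℤ/b × ℤ/(m n)` (`m`, `n` coprime) read on `SeedType [a, b, m, n] = ℤ/a × (ℤ/b × (ℤ/m × ℤ/n))`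
(Chinese remainder theorem on the last factor). [cite: CohnKleinbergSzegedyUmans2005, Def. 5.1] -/
theorem not_exists_isSTPP_211_seedQuad {a b m n k : ℕ} (h : m.Coprime n)
    (hneg : ¬ ∃ A B C : Fin k → Finset (ZMod a × (ZMod b × ZMod (m * n))), IsSTPP A B C ∧
      ∀ i, (A i).card = 2 ∧ (B i).card = 1 ∧ (C i).card = 1) :
    ¬ ∃ A B C : Fin k → Finset (SeedType [a, b, m, n]), IsSTPP A B C ∧
      ∀ i, (A i).card = 2 ∧ (B i).card = 1 ∧ (C i).card = 1 :=
  let e : ZMod a × (ZMod b × (ZMod m × ZMod n)) ≃+ ZMod a × (ZMod b × ZMod (m * n)) :=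
    AddEquiv.prodCongr (AddEquiv.refl (ZMod a))
      (AddEquiv.prodCongr (AddEquiv.refl (ZMod b)) (ZMod.chineseRemainder h).symm.toAddEquiv)
  fun hex => hneg (exists_isSTPP_211_of_injective e.toAddMonoidHom e.injective hex)

/-- The six abelian groups of order `24, 25, 26`, as lists of prime-power moduli (`SeedType`). -/
def noneLists211K6A : List (List ℕ) :=
  [[8, 3], [2, 4, 3], [2, 2, 2, 3], [25], [5, 5], [2, 13]]

/-- COMBINATORIAL CORE (kernel): every capped multiset of prime powers with product in `[24, 26]` is one of the six types. -/
theorem noneList211K6A_of_capped : ∀ E ∈ List.range' 1 26, ∀ M ∈ subMS (capList E), 24 ≤ M.prod → M.prod ≤ 26 →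
    ∃ s ∈ noneLists211K6A, dom s M = true ∧ s.prod = M.prod := by
  decide +kernel

/-- Each of the six groups admits no `(2,1,1)⁶` (the kernel cells; cyclic ones through the CRT).
[cite: CohnKleinbergSzegedyUmans2005, Def. 5.1] -/
theorem not_211pow6_of_mem_noneLists211K6A : ∀ s ∈ noneLists211K6A, ¬ ∃ A B C : Fin 6 → Finset (SeedType s),
    IsSTPP A B C ∧ ∀ i, (A i).card = 2 ∧ (B i).card = 1 ∧ (C i).card = 1 := by
  intro s hs
  simp only [noneLists211K6A, List.mem_cons, List.mem_nil_iff, or_false] at hs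
  rcases hs with rfl | rfl | rfl | rfl | rfl | rfl
  · exact not_exists_isSTPP_211_seedPair (by norm_num) not_exists_isSTPP_211pow6_zmod24
  · exact not_exists_isSTPP_211_seedTriple (by norm_num) not_exists_isSTPP_211pow6_z2_z12
  · exact not_exists_isSTPP_211_seedQuad (by norm_num) not_exists_isSTPP_211pow6_z2_z2_z6
  · exact not_exists_isSTPP_211pow6_zmod25
  · exact not_exists_isSTPP_211pow6_z5_z5
  · exact not_exists_isSTPP_211_seedPair (by norm_num) not_exists_isSTPP_211pow6_zmod26

/-- **No finite abelian group of order `≤ 26` admits an STPP family of size pattern `(2,1,1)⁶`** (CKSU Def. 5.1, tree `IsSTPP`):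
orders `≤ 23` by the `k = 5` lower side (sub-families), orders `24, 25, 26` by the six kernel cells through the structure theorem.
No `ω` bound follows. [cite: CohnKleinbergSzegedyUmans2005, Def. 5.1] -/
theorem not_exists_isSTPP_211pow6_of_card_le_26 {G : Type*} [AddCommGroup G] [Finite G] (hG : Nat.card G ≤ 26) :
    ¬ ∃ A B C : Fin 6 → Finset G, IsSTPP A B C ∧ ∀ i, (A i).card = 2 ∧ (B i).card = 1 ∧ (C i).card = 1 := by
  by_cases h24 : 24 ≤ Nat.card G
  · exact not_exists_isSTPP_211_of_card_window45 (by norm_num) noneList211K6A_of_capped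
      not_211pow6_of_mem_noneLists211K6A h24 hG
  · exact not_exists_isSTPP_211_mono (by norm_num) (not_exists_isSTPP_211pow5_of_card_le (by omega))

end Summit.MatrixMultiplication.OmegaCensus
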